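import Mathlib
import Literature.Analysis.FluidPDE.TypeIICoreWitness
import Literature.Analysis.FluidPDE.ClassicalSolution
import Literature.Analysis.FluidPDE.EulerTimeScaling
import Literature.Analysis.FluidPDE.KNSSThm53OfWindow
import Summits.NavierStokesRegularity.NavierStokesRegularity.Theorems.TypeIIInviscidRelaxationCoreExclusionSingularPoint
import Summits.NavierStokesRegularity.NavierStokesRegularity.Theorems.TypeIIInviscidRelaxationCoreExclusionAnchorReduction
import Summits.NavierStokesRegularity.NavierStokesRegularity.Theorems.TypeIIInviscidRelaxationCoreExclusionAnchorReductionAxisym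
import HarnessLib

/-!
# Crux `MonopoleCoreExclusion` (stmt-NavierStokesRegularity-1965): for COVERING axisymmetric witnesses the
# anchor stub is free — core-length inflation of an isolated axisymmetric core

`--supports stmt-NavierStokesRegularity-1965` (helper file; theorems only, no definitions, no `sorry`; outside the
import cone of the route file).  Positive twin of the negative-side file
`…MonopoleCoreExclusionAnchorObstruction` (p832438: a SPOILER shell bounds the core length of every axisymmetric
witness): WITHOUT a spoiler the core length of an axisymmetric witness can be INFLATED at will, and then the two
research clauses of the registered anchor stub `stub_anchoredLateAxisymWitness` (line `axisymmetric_comparison_flow`)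
— LATENESS `(T - t)·V ≤ K·L` and ANCHORING `dist xs x₀ ≤ K·L/4` at the singular point — cost nothing.

* §1 `axisymWitness_inflate` (witness algebra).  Let `(x₀, L, V, Q, W)` satisfy the level-`K` clauses (`K ≥ 1`) of
  an axisymmetric core witness for the slice `u t`, and let `L' ≥ L`.  If the slice is SLOW on the annulus
  `K·L < dist x x₀ ≤ K·L'` — `‖u t x‖ ≤ V/K` there (no second core within `K·L'` of the centre) — then
  `(x₀, L', V, Q, W')` satisfies the same level-`K` clauses, where `W'` is the TRUNCATED–RESCALED profile
  `W' y = W((L'/L)y)` for `‖(L'/L)y‖ ≤ K` and `0` otherwise (axisymmetric: centred balls are `rotZ`-invariant and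
  `rotZ θ 0 = 0`).  The columnar class admits no such inflation (the column over the core disc leaves every ball:
  `…ColumnarCoreExclusionCoreExtent`, p835003).
* §2 `lateAnchored_of_coveringAxisymWitness`.  If the slice is slow everywhere outside the witness ball
  (`‖u t x‖ ≤ V/K` for `dist x x₀ > K·L`: a COVERING witness), then for ANY `T` and ANY point `xs` the inflated
  datum with `L' = max L (max ((T-t)V/K) (4·dist xs x₀/K))` is late and anchored at `xs`.
* §3 `anchoredLateAxisymWitness_of_coveringWitnesses`.  Consequently, in the binder shape of the registered stub:
  a maximal smooth Leray–Hopf solution from a rapidly decaying datum which carries COVERING axisymmetric witnesses at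
  every level (at one time `0 < t < T` per level suffices) satisfies the FULL conclusion of
  `stub_anchoredLateAxisymWitness` — the singular anchor from `exists_singular_point_of_isMaximalSmoothSolution`
  (p830444), levels `K < 1` by `lateAnchoredWitness_of_level_le` (p831087).  Neither the non-Type-I hypothesis nor
  any rate information is used: for isolated axisymmetric cores lateness is NOT a rate statement (contrast: for the
  columnar class late witnesses force the Euler ceiling `(T-t)V ≤ 2R_far`, p835003).
* §4 `monopoleCoreExclusion_covering_of_shadowing`.  Hence, for covering witnesses, the line
  `axisymmetric_comparison_flow` closes from the landed transfer stub (its conclusion `hComp`, verbatim) and the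
  registered shadowing stub (`hShadow`, verbatim) ALONE: the whole content of the crux restricted to isolated
  near-axisymmetric cores is `stub_axisymShadowing`.

Census consequence (this hand): the research residue of the [L] anchor stub of crux 1965 is exactly the NON-COVERING
case (a second structure of speed `> V/K` outside the witness ball — the spoiler of p832438); a re-typed relaxation
output "covering axisymmetric witnesses" makes the anchor stub a theorem.  Nothing about Navier–Stokes regularity is
claimed; no stub or crux is proved here.
-/

noncomputable section

open Set Metric MeasureTheory Function Filter Topology
open Literature.Analysis Literature.Analysis.FluidPDE

namespace Summit.NavierStokesRegularity.NavierStokesRegularity.Theorems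

-- the problem directory repeats the summit name (`NavierStokesRegularity/NavierStokesRegularity`)
set_option linter.dupNamespace false

namespace MonopoleWitnessInflation

open CoreExclusionAnchor

/-! ### §0 Truncation of an axisymmetric profile outside a centred ball -/

/-- **Truncation outside a centred ball keeps axisymmetry**: if `W` is axisymmetric, so is
`y ↦ if ‖c • y‖ ≤ R then W (c • y) else 0` (centred balls are `rotZ`-invariant, `rotZ θ 0 = 0`; tree lemmas `rotZ_smul`,
`rotZ_apply_zero_vec`). [folklore] -/
theorem isAxisymmetric_truncate_dilate {W : EuclideanSpace ℝ (Fin 3) → EuclideanSpace ℝ (Fin 3)}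
    (hW : IsAxisymmetric W) (c R : ℝ) :
    IsAxisymmetric (fun y => if ‖c • y‖ ≤ R then W (c • y) else 0) := by
  intro θ y
  have hn : ‖c • rotZ θ y‖ = ‖c • y‖ := by rw [← rotZ_smul, norm_rotZ]
  show (if ‖c • rotZ θ y‖ ≤ R then W (c • rotZ θ y) else 0) =
    rotZ θ (if ‖c • y‖ ≤ R then W (c • y) else 0)
  by_cases h : ‖c • y‖ ≤ R
  · have h' : ‖c • rotZ θ y‖ ≤ R := by rw [hn]; exact h
    rw [if_pos h', if_pos h, ← rotZ_smul, hW θ (c • y)]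
  · have h' : ¬ ‖c • rotZ θ y‖ ≤ R := by rw [hn]; exact h
    rw [if_neg h', if_neg h, rotZ_apply_zero_vec]

/-! ### §1 Core-length inflation of an axisymmetric witness over a slow annulus -/

/-- **Inflation of an axisymmetric core witness.**  Let `(x₀, L, V, Q, W)` satisfy, for the slice `u t`, the
level-`K` (`K ≥ 1`) near-maximum, oscillation, Reynolds and closeness clauses of an axisymmetric core witness, and
let `L' ≥ L`.  If `‖u t x‖ ≤ V/K` on the annulus `K·L < dist x x₀ ≤ K·L'`, then `(x₀, L', V, Q, W')` satisfies the
same level-`K` clauses with the axisymmetric truncated–rescaled profile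
`W' y = if ‖(L'/L) • y‖ ≤ K then W ((L'/L) • y) else 0`.  (Inside the old ball the rescaled slice is unchanged;
on the annulus it is `K⁻¹`-small and `W' = 0`; the unit ball of `W'` contains a copy of the unit ball of `W`
because `K ≥ 1`.) [folklore] -/
theorem axisymWitness_inflate {ν K t L L' V : ℝ}
    {u : ℝ → EuclideanSpace ℝ (Fin 3) → EuclideanSpace ℝ (Fin 3)} {x₀ : EuclideanSpace ℝ (Fin 3)}
    {Q : EuclideanSpace ℝ (Fin 3) ≃ₗᵢ[ℝ] EuclideanSpace ℝ (Fin 3)}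
    {W : EuclideanSpace ℝ (Fin 3) → EuclideanSpace ℝ (Fin 3)}
    (hK : 1 ≤ K) (hL : 0 < L) (hLL' : L ≤ L') (hV : 0 < V) (hW : IsAxisymmetric W)
    (hnear : ∃ x₁, dist x₁ x₀ ≤ L ∧ V ≤ 2 * ‖u t x₁‖)
    (hosc : ∃ y y' : EuclideanSpace ℝ (Fin 3), ‖y‖ ≤ 1 ∧ ‖y'‖ ≤ 1 ∧ (4 : ℝ)⁻¹ ≤ ‖W y - W y'‖)
    (hRe : K * ν ≤ L * V)
    (hclose : ∀ y : EuclideanSpace ℝ (Fin 3), ‖y‖ ≤ K →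
      ‖V⁻¹ • Q.symm (u t (x₀ + L • Q y)) - W y‖ ≤ K⁻¹)
    (hslow : ∀ x : EuclideanSpace ℝ (Fin 3), K * L < dist x x₀ → dist x x₀ ≤ K * L' → ‖u t x‖ ≤ V / K) :
    IsAxisymmetric (fun y : EuclideanSpace ℝ (Fin 3) => if ‖(L' / L) • y‖ ≤ K then W ((L' / L) • y) else 0) ∧
      (∃ x₁, dist x₁ x₀ ≤ L' ∧ V ≤ 2 * ‖u t x₁‖) ∧
      (∃ y y' : EuclideanSpace ℝ (Fin 3), ‖y‖ ≤ 1 ∧ ‖y'‖ ≤ 1 ∧ (4 : ℝ)⁻¹ ≤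
        ‖(fun y : EuclideanSpace ℝ (Fin 3) => if ‖(L' / L) • y‖ ≤ K then W ((L' / L) • y) else 0) y -
          (fun y : EuclideanSpace ℝ (Fin 3) => if ‖(L' / L) • y‖ ≤ K then W ((L' / L) • y) else 0) y'‖) ∧
      K * ν ≤ L' * V ∧
      (∀ y : EuclideanSpace ℝ (Fin 3), ‖y‖ ≤ K →
        ‖V⁻¹ • Q.symm (u t (x₀ + L' • Q y)) -
          (fun y : EuclideanSpace ℝ (Fin 3) => if ‖(L' / L) • y‖ ≤ K then W ((L' / L) • y) else 0) y‖ ≤ K⁻¹) := by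
  have hK0 : 0 < K := one_pos.trans_le hK
  have hL' : 0 < L' := hL.trans_le hLL'
  set c : ℝ := L' / L with hc
  have hc1 : 1 ≤ c := by rw [hc, le_div_iff₀ hL, one_mul]; exact hLL'
  have hc0 : 0 < c := one_pos.trans_le hc1
  have hcL : c * L = L' := by rw [hc]; field_simp
  refine ⟨isAxisymmetric_truncate_dilate hW c K, ?_, ?_, ?_, ?_⟩
  · -- near-maximum: monotone in the core length
    obtain ⟨x₁, hx₁, hVx₁⟩ := hnear
    exact ⟨x₁, hx₁.trans hLL', hVx₁⟩
  · -- oscillation: the points `c⁻¹ y`, `c⁻¹ y'` lie in the unit ball and map into the old unit ball `⊆ {‖·‖ ≤ K}`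
    obtain ⟨y, y', hy, hy', hW⟩ := hosc
    have hinv : c⁻¹ ≤ 1 := inv_le_one_of_one_le₀ hc1
    have hn : ∀ z : EuclideanSpace ℝ (Fin 3), ‖z‖ ≤ 1 → ‖c⁻¹ • z‖ ≤ 1 := fun z hz => by
      rw [norm_smul, Real.norm_of_nonneg (inv_nonneg.2 hc0.le)]
      exact (mul_le_mul hinv hz (norm_nonneg _) zero_le_one).trans_eq (one_mul 1)
    have hcz : ∀ z : EuclideanSpace ℝ (Fin 3), c • (c⁻¹ • z) = z := fun z => by
      rw [smul_smul, mul_inv_cancel₀ hc0.ne', one_smul]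
    refine ⟨c⁻¹ • y, c⁻¹ • y', hn y hy, hn y' hy', ?_⟩
    simp only [hcz, hy.trans hK, hy'.trans hK, if_true]
    exact hW
  · -- Reynolds: monotone in the core length
    exact hRe.trans (mul_le_mul_of_nonneg_right hLL' hV.le)
  · -- closeness on `‖y‖ ≤ K`
    intro y hy
    have harg : x₀ + L' • Q (y) = x₀ + L • Q (c • y) := by
      rw [Q.map_smul, smul_smul, mul_comm L c, hcL]
    by_cases h : ‖c • y‖ ≤ K
    · -- inside the old witness ball: the old closeness
      simp only [h, if_true]
      rw [harg]
      exact hclose (c • y) h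
    · -- on the slow annulus: the rescaled slice is `K⁻¹`-small and `W' = 0`
      simp only [h, if_false, sub_zero]
      push Not at h
      have hdist : dist (x₀ + L' • Q y) x₀ = L' * ‖y‖ := by
        rw [dist_eq_norm, add_sub_cancel_left, norm_smul, Real.norm_of_nonneg hL'.le, Q.norm_map]
      have hcy : ‖c • y‖ = c * ‖y‖ := by rw [norm_smul, Real.norm_of_nonneg hc0.le]
      have hlow : K * L < dist (x₀ + L' • Q y) x₀ := by
        rw [hdist, ← hcL]
        calc K * L < c * ‖y‖ * L := by
              exact mul_lt_mul_of_pos_right (hcy ▸ h) hL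
          _ = c * L * ‖y‖ := by ring
      have hup : dist (x₀ + L' • Q y) x₀ ≤ K * L' := by
        rw [hdist, mul_comm]
        exact mul_le_mul_of_nonneg_right hy hL'.le
      have hux := hslow _ hlow hup
      rw [norm_smul, Real.norm_of_nonneg (inv_nonneg.2 hV.le), LinearIsometryEquiv.norm_map]
      rw [le_div_iff₀ hK0] at hux
      rw [inv_mul_le_iff₀ hV]
      calc ‖u t (x₀ + L' • Q y)‖ ≤ ‖u t (x₀ + L' • Q y)‖ * K * K⁻¹ := by
            rw [mul_assoc, mul_inv_cancel₀ hK0.ne', mul_one]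
        _ ≤ V * K⁻¹ := mul_le_mul_of_nonneg_right hux (inv_nonneg.2 hK0.le)

/-! ### §2 Lateness and anchoring of a covering axisymmetric witness are free -/

/-- **A covering axisymmetric witness is late and anchored after inflation.**  Let `(x₀, L, V, Q, W)` satisfy the
level-`K` (`K ≥ 1`) clauses of an axisymmetric core witness for `u t` and let the witness be COVERING: the slice is
slow, `‖u t x‖ ≤ V/K`, everywhere outside the ball `dist x x₀ ≤ K·L`.  Then for every horizon `T` and every point
`xs` there are a core length `L' ≥ L` and an axisymmetric profile `W'` with the same level-`K` clauses and moreover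
`(T - t)·V ≤ K·L'` (late) and `dist xs x₀ ≤ K·L'/4` (anchored at `xs`):
`L' = max L (max ((T-t)V/K) (4 dist xs x₀ / K))`. [folklore] -/
theorem lateAnchored_of_coveringAxisymWitness {ν K T t L V : ℝ}
    {u : ℝ → EuclideanSpace ℝ (Fin 3) → EuclideanSpace ℝ (Fin 3)} {x₀ : EuclideanSpace ℝ (Fin 3)}
    {Q : EuclideanSpace ℝ (Fin 3) ≃ₗᵢ[ℝ] EuclideanSpace ℝ (Fin 3)}
    {W : EuclideanSpace ℝ (Fin 3) → EuclideanSpace ℝ (Fin 3)}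
    (hK : 1 ≤ K) (hL : 0 < L) (hV : 0 < V) (hW : IsAxisymmetric W)
    (hnear : ∃ x₁, dist x₁ x₀ ≤ L ∧ V ≤ 2 * ‖u t x₁‖)
    (hosc : ∃ y y' : EuclideanSpace ℝ (Fin 3), ‖y‖ ≤ 1 ∧ ‖y'‖ ≤ 1 ∧ (4 : ℝ)⁻¹ ≤ ‖W y - W y'‖)
    (hRe : K * ν ≤ L * V)
    (hclose : ∀ y : EuclideanSpace ℝ (Fin 3), ‖y‖ ≤ K →
      ‖V⁻¹ • Q.symm (u t (x₀ + L • Q y)) - W y‖ ≤ K⁻¹)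
    (hcover : ∀ x : EuclideanSpace ℝ (Fin 3), K * L < dist x x₀ → ‖u t x‖ ≤ V / K)
    (xs : EuclideanSpace ℝ (Fin 3)) :
    ∃ (L' : ℝ) (W' : EuclideanSpace ℝ (Fin 3) → EuclideanSpace ℝ (Fin 3)),
      0 < L' ∧ IsAxisymmetric W' ∧
      (∃ x₁, dist x₁ x₀ ≤ L' ∧ V ≤ 2 * ‖u t x₁‖) ∧
      (∃ y y' : EuclideanSpace ℝ (Fin 3), ‖y‖ ≤ 1 ∧ ‖y'‖ ≤ 1 ∧ (4 : ℝ)⁻¹ ≤ ‖W' y - W' y'‖) ∧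
      K * ν ≤ L' * V ∧
      (∀ y : EuclideanSpace ℝ (Fin 3), ‖y‖ ≤ K →
        ‖V⁻¹ • Q.symm (u t (x₀ + L' • Q y)) - W' y‖ ≤ K⁻¹) ∧
      (T - t) * V ≤ K * L' ∧ dist xs x₀ ≤ K * L' / 4 := by
  have hK0 : 0 < K := one_pos.trans_le hK
  set L' : ℝ := max L (max ((T - t) * V / K) (4 * dist xs x₀ / K)) with hL'_def
  have hLL' : L ≤ L' := le_max_left _ _
  have hL' : 0 < L' := hL.trans_le hLL'
  obtain ⟨hax, hnear', hosc', hRe', hclose'⟩ :=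
    axisymWitness_inflate (ν := ν) (t := t) (u := u) (Q := Q) hK hL hLL' hV hW hnear hosc hRe hclose
      (fun x hx _ => hcover x hx)
  refine ⟨L', _, hL', hax, hnear', hosc', hRe', hclose', ?_, ?_⟩
  · -- late
    have h1 : (T - t) * V / K ≤ L' := (le_max_left _ _).trans (le_max_right _ _)
    rw [div_le_iff₀ hK0] at h1
    linarith [mul_comm L' K]
  · -- anchored
    have h1 : 4 * dist xs x₀ / K ≤ L' := (le_max_right _ _).trans (le_max_right _ _)
    rw [div_le_iff₀ hK0] at h1
    linarith [mul_comm L' K]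

/-! ### §3 The anchor stub of crux 1965 for covering witnesses -/

/-- **`stub_anchoredLateAxisymWitness` holds for COVERING witnesses** (binder shape of the registered stub of line
`axisymmetric_comparison_flow`, crux `MonopoleCoreExclusion`, stmt-1965).  Let `(u, p)` be a maximal smooth solution
on `[0,T)`, Leray–Hopf from its rapidly decaying datum, and assume that at every level `K > 0`, after every `t₀ < T`,
some slice `u t` (`t₀ < t < T`) carries a level-`K` axisymmetric core witness `(x₀, L, V, Q, W)` which is COVERING
(`‖u t x‖ ≤ V/K` for `dist x x₀ > K·L`).  Then there is a point `xs`, singular at time `T`, such that for every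
`K > 0` some level-`K` axisymmetric witness at a time `0 < t < T` is LATE, `(T - t)·V ≤ K·L`, and ANCHORED at `xs`,
`dist xs x₀ ≤ K·L/4`.  (Singular point: `exists_singular_point_of_isMaximalSmoothSolution`; levels `≥ 1`: inflation,
§2; levels `< 1`: level descent `lateAnchoredWitness_of_level_le` from level `1`.)  No rate hypothesis (in particular
not `¬ IsTypeIBlowup`) is used. [folklore] -/
theorem anchoredLateAxisymWitness_of_coveringWitnesses {ν T : ℝ}
    {u : ℝ → EuclideanSpace ℝ (Fin 3) → EuclideanSpace ℝ (Fin 3)}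
    {p : ℝ → EuclideanSpace ℝ (Fin 3) → ℝ}
    (hν : 0 < ν) (hT : 0 < T) (hmax : IsMaximalSmoothSolution ν 0 u p T)
    (hLH : IsLerayHopfOn T ν 0 (u 0) u) (hdec : HasRapidSpatialDecay (u 0))
    (hwc : ∀ K : ℝ, 0 < K → ∀ t₀ < T, ∃ t, t₀ < t ∧ t < T ∧
      ∃ (x₀ : EuclideanSpace ℝ (Fin 3)) (L V : ℝ)
        (Q : EuclideanSpace ℝ (Fin 3) ≃ₗᵢ[ℝ] EuclideanSpace ℝ (Fin 3))
        (W : EuclideanSpace ℝ (Fin 3) → EuclideanSpace ℝ (Fin 3)),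
        0 < L ∧ 0 < V ∧ IsAxisymmetric W ∧ (∀ x, ‖u t x‖ ≤ V) ∧
        (∃ x₁, dist x₁ x₀ ≤ L ∧ V ≤ 2 * ‖u t x₁‖) ∧
        (∃ y y' : EuclideanSpace ℝ (Fin 3), ‖y‖ ≤ 1 ∧ ‖y'‖ ≤ 1 ∧ (4 : ℝ)⁻¹ ≤ ‖W y - W y'‖) ∧
        K * ν ≤ L * V ∧
        (∀ y : EuclideanSpace ℝ (Fin 3), ‖y‖ ≤ K →
          ‖V⁻¹ • Q.symm (u t (x₀ + L • Q y)) - W y‖ ≤ K⁻¹) ∧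
        (∀ x : EuclideanSpace ℝ (Fin 3), K * L < dist x x₀ → ‖u t x‖ ≤ V / K)) :
    ∃ xs : EuclideanSpace ℝ (Fin 3),
      (¬ ∃ ρ M : ℝ, 0 < ρ ∧ ∀ s ∈ Ioo (T - ρ ^ 2) T, ∀ x ∈ ball xs ρ, ‖u s x‖ ≤ M) ∧
      ∀ K : ℝ, 0 < K → ∃ t : ℝ, 0 < t ∧ t < T ∧
        ∃ (x₀ : EuclideanSpace ℝ (Fin 3)) (L V : ℝ)
          (Q : EuclideanSpace ℝ (Fin 3) ≃ₗᵢ[ℝ] EuclideanSpace ℝ (Fin 3))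
          (W : EuclideanSpace ℝ (Fin 3) → EuclideanSpace ℝ (Fin 3)),
          0 < L ∧ 0 < V ∧ IsAxisymmetric W ∧ (∀ x, ‖u t x‖ ≤ V) ∧
          (∃ x₁, dist x₁ x₀ ≤ L ∧ V ≤ 2 * ‖u t x₁‖) ∧
          (∃ y y' : EuclideanSpace ℝ (Fin 3), ‖y‖ ≤ 1 ∧ ‖y'‖ ≤ 1 ∧ (4 : ℝ)⁻¹ ≤ ‖W y - W y'‖) ∧
          K * ν ≤ L * V ∧
          (∀ y : EuclideanSpace ℝ (Fin 3), ‖y‖ ≤ K →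
            ‖V⁻¹ • Q.symm (u t (x₀ + L • Q y)) - W y‖ ≤ K⁻¹) ∧
          (T - t) * V ≤ K * L ∧ dist xs x₀ ≤ K * L / 4 := by
  obtain ⟨xs, hxs⟩ := exists_singular_point_of_isMaximalSmoothSolution hν hT hmax hLH hdec
  refine ⟨xs, hxs, fun K hK => ?_⟩
  -- a covering witness at the level `K₁ = max K 1 ≥ 1`, at some time `0 < t < T`
  set K₁ : ℝ := max K 1 with hK₁_def
  have hK₁1 : 1 ≤ K₁ := le_max_right _ _
  have hKK₁ : K ≤ K₁ := le_max_left _ _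
  have hK₁0 : 0 < K₁ := hK.trans_le hKK₁
  obtain ⟨t, ht0, htT, x₀, L, V, Q, W, hL, hV, hW, hbd, hnear, hosc, hRe, hclose, hcover⟩ :=
    hwc K₁ hK₁0 0 hT
  -- inflate: late and anchored at level `K₁`
  obtain ⟨L', W', hL', hW', hnear', hosc', hRe', hclose', hlate', hdist'⟩ :=
    lateAnchored_of_coveringAxisymWitness (ν := ν) (T := T) hK₁1 hL hV hW hnear hosc hRe hclose hcover xs
  -- descend to level `K ≤ K₁`
  obtain ⟨L'', W'', hL'', hW'', hnear'', hosc'', hRe'', hclose'', hlate'', hdist''⟩ :=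
    lateAnchoredWitness_of_level_le (C := IsAxisymmetric) (fun _ hW c _ => isAxisymmetric_dilate hW c)
      hν.le hK hKK₁ hL' hV hW' hnear' hosc' hRe' hclose' hlate' hdist'
  exact ⟨t, ht0, htT, x₀, L'', V, Q, W'', hL'', hV, hW'', hbd, hnear'', hosc'', hRe'', hclose'', hlate'', hdist''⟩

/-! ### §4 The line closes for covering witnesses from the transfer and the shadowing stub alone -/

/-- **Crux `MonopoleCoreExclusion` restricted to COVERING axisymmetric witnesses follows from the shadowing stub
(given the transfer).**  Assume the conclusion of the landed transfer stub
`AxisymComparisonFlow.stub_axisymComparisonFlowOfAX hAX` (hypothesis `hComp`, verbatim) and the statement of the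
registered stub `stub_axisymShadowing` (hypothesis `hShadow`, verbatim).  Then no maximal smooth solution on `[0,T)`,
Leray–Hopf from a rapidly decaying datum, carries covering axisymmetric core witnesses at every level frequently
before `T`: §3 gives the singular anchor `xs` and an anchored late level-`K₀` witness, `hComp` the comparison flow,
`hShadow` a bound on `[t,T) × B(x₀, K₀L/2) ⊇ (T-ρ²,T) × B_ρ(xs)`, `ρ = min (K₀L/4) √(T-t)` — contradiction.  (The
composition of the skeleton `Lines/axisymmetric_comparison_flow.lean`, with §3 in place of the anchor stub.)
[folklore] -/
theorem monopoleCoreExclusion_covering_of_shadowing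
    (hComp : ∃ A : ℝ, 0 < A ∧
      ∀ (ν T t K : ℝ) (u : ℝ → EuclideanSpace ℝ (Fin 3) → EuclideanSpace ℝ (Fin 3))
        (p : ℝ → EuclideanSpace ℝ (Fin 3) → ℝ),
        0 < ν → 0 < T → IsClassicalNSSolutionOn (Ico 0 T) ν 0 u p → IsLerayHopfOn T ν 0 (u 0) u →
        HasRapidSpatialDecay (u 0) → 0 < t → t < T → 1 ≤ K →
        ∀ (x₀ : EuclideanSpace ℝ (Fin 3)) (L V : ℝ)
          (Q : EuclideanSpace ℝ (Fin 3) ≃ₗᵢ[ℝ] EuclideanSpace ℝ (Fin 3))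
          (W : EuclideanSpace ℝ (Fin 3) → EuclideanSpace ℝ (Fin 3)),
          0 < L → 0 < V → IsAxisymmetric W → (∀ x, ‖u t x‖ ≤ V) → K * ν ≤ L * V →
          (∀ y : EuclideanSpace ℝ (Fin 3), ‖y‖ ≤ K →
            ‖V⁻¹ • Q.symm (u t (x₀ + L • Q y)) - W y‖ ≤ K⁻¹) →
          ∃ (v : ℝ → EuclideanSpace ℝ (Fin 3) → EuclideanSpace ℝ (Fin 3))
            (q : ℝ → EuclideanSpace ℝ (Fin 3) → ℝ) (Mv : ℝ),
            IsClassicalNSSolutionOn (Icc t T) ν 0 v q ∧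
            (∀ s ∈ Icc t T, IsAxisymmetric (fun y : EuclideanSpace ℝ (Fin 3) => Q.symm (v s (x₀ + Q y)))) ∧
            (∀ s ∈ Icc t T, ∀ x, ‖v s x‖ ≤ Mv) ∧
            (∀ x ∈ ball x₀ (K * L), ‖u t x - v t x‖ ≤ A * V / K))
    (hShadow : ∀ A : ℝ, 0 < A → ∃ K₀ : ℝ, 1 ≤ K₀ ∧ ∀ K : ℝ, K₀ ≤ K →
      ∀ (ν T t : ℝ) (u : ℝ → EuclideanSpace ℝ (Fin 3) → EuclideanSpace ℝ (Fin 3))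
        (p : ℝ → EuclideanSpace ℝ (Fin 3) → ℝ),
        0 < ν → 0 < T → IsClassicalNSSolutionOn (Ico 0 T) ν 0 u p → IsLerayHopfOn T ν 0 (u 0) u →
        HasRapidSpatialDecay (u 0) → 0 < t → t < T →
        ∀ (x₀ : EuclideanSpace ℝ (Fin 3)) (L V : ℝ)
          (Q : EuclideanSpace ℝ (Fin 3) ≃ₗᵢ[ℝ] EuclideanSpace ℝ (Fin 3)),
          0 < L → 0 < V → (∀ x, ‖u t x‖ ≤ V) →
          (∃ x₁, dist x₁ x₀ ≤ L ∧ V ≤ 2 * ‖u t x₁‖) → K * ν ≤ L * V → (T - t) * V ≤ K * L →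
          ∀ (v : ℝ → EuclideanSpace ℝ (Fin 3) → EuclideanSpace ℝ (Fin 3))
            (q : ℝ → EuclideanSpace ℝ (Fin 3) → ℝ) (Mv : ℝ),
            IsClassicalNSSolutionOn (Icc t T) ν 0 v q →
            (∀ s ∈ Icc t T, IsAxisymmetric (fun y : EuclideanSpace ℝ (Fin 3) => Q.symm (v s (x₀ + Q y)))) →
            (∀ s ∈ Icc t T, ∀ x, ‖v s x‖ ≤ Mv) →
            (∀ x ∈ ball x₀ (K * L), ‖u t x - v t x‖ ≤ A * V / K) →
            ∃ M : ℝ, ∀ s ∈ Ico t T, ∀ x ∈ ball x₀ (K * L / 2), ‖u s x‖ ≤ M)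
    {ν T : ℝ} {u : ℝ → EuclideanSpace ℝ (Fin 3) → EuclideanSpace ℝ (Fin 3)}
    {p : ℝ → EuclideanSpace ℝ (Fin 3) → ℝ}
    (hν : 0 < ν) (hT : 0 < T) (hmax : IsMaximalSmoothSolution ν 0 u p T)
    (hLH : IsLerayHopfOn T ν 0 (u 0) u) (hdec : HasRapidSpatialDecay (u 0))
    (hwc : ∀ K : ℝ, 0 < K → ∀ t₀ < T, ∃ t, t₀ < t ∧ t < T ∧
      ∃ (x₀ : EuclideanSpace ℝ (Fin 3)) (L V : ℝ)
        (Q : EuclideanSpace ℝ (Fin 3) ≃ₗᵢ[ℝ] EuclideanSpace ℝ (Fin 3))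
        (W : EuclideanSpace ℝ (Fin 3) → EuclideanSpace ℝ (Fin 3)),
        0 < L ∧ 0 < V ∧ IsAxisymmetric W ∧ (∀ x, ‖u t x‖ ≤ V) ∧
        (∃ x₁, dist x₁ x₀ ≤ L ∧ V ≤ 2 * ‖u t x₁‖) ∧
        (∃ y y' : EuclideanSpace ℝ (Fin 3), ‖y‖ ≤ 1 ∧ ‖y'‖ ≤ 1 ∧ (4 : ℝ)⁻¹ ≤ ‖W y - W y'‖) ∧
        K * ν ≤ L * V ∧
        (∀ y : EuclideanSpace ℝ (Fin 3), ‖y‖ ≤ K →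
          ‖V⁻¹ • Q.symm (u t (x₀ + L • Q y)) - W y‖ ≤ K⁻¹) ∧
        (∀ x : EuclideanSpace ℝ (Fin 3), K * L < dist x x₀ → ‖u t x‖ ≤ V / K)) :
    False := by
  obtain ⟨A, hA, hcomp⟩ := hComp
  obtain ⟨K₀, hK₀1, hstab⟩ := hShadow A hA
  have hK₀ : 0 < K₀ := lt_of_lt_of_le one_pos hK₀1
  obtain ⟨xs, hsing, hcov⟩ := anchoredLateAxisymWitness_of_coveringWitnesses hν hT hmax hLH hdec hwc
  obtain ⟨t, ht0, htT, x₀, L, V, Q, W, hL, hV, hax, hbd, hnear, hosc, hRe, hclose, hlate, hdist⟩ :=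
    hcov K₀ hK₀
  obtain ⟨v, q, Mv, hv, hvax, hvbd, hvclose⟩ :=
    hcomp ν T t K₀ u p hν hT hmax.1 hLH hdec ht0 htT hK₀1 x₀ L V Q W hL hV hax hbd hRe hclose
  obtain ⟨M, hM⟩ := hstab K₀ le_rfl ν T t u p hν hT hmax.1 hLH hdec ht0 htT x₀ L V Q hL hV hbd hnear
    hRe hlate v q Mv hv hvax hvbd hvclose
  apply hsing
  have hTt : 0 < T - t := sub_pos.2 htT
  set ρ : ℝ := min (K₀ * L / 4) (Real.sqrt (T - t)) with hρ
  have hρpos : 0 < ρ := lt_min (by positivity) (Real.sqrt_pos.2 hTt)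
  have hρsq : ρ ^ 2 ≤ T - t :=
    calc ρ ^ 2 ≤ (Real.sqrt (T - t)) ^ 2 := pow_le_pow_left₀ hρpos.le (min_le_right _ _) 2
      _ = T - t := Real.sq_sqrt hTt.le
  have hρle : ρ ≤ K₀ * L / 4 := min_le_left _ _
  refine ⟨ρ, M, hρpos, fun s hs x hx => hM s ⟨?_, hs.2⟩ x ?_⟩
  · linarith [hs.1]
  · rw [mem_ball] at hx ⊢
    calc dist x x₀ ≤ dist x xs + dist xs x₀ := dist_triangle _ _ _
      _ < ρ + K₀ * L / 4 := by linarith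
      _ ≤ K₀ * L / 4 + K₀ * L / 4 := by linarith
      _ = K₀ * L / 2 := by ring

end MonopoleWitnessInflation

end Summit.NavierStokesRegularity.NavierStokesRegularity.Theorems

end
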